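import Literature.Probability.Percolation.FlipResponse

/-!
# Locality of the flip response: a flip outside the window does not respond

Helper file for the crux `QuadrupoleSelectionRule` (stmt-CriticalPhenomena-7029, informal) of route
`CardyFlipRusso` (sub-problem `CardyFormulaZ2`), line `Sketch`, generation 3.

Connection events `siteConnIn G S x y` read the graph `G` only through its edges with BOTH
endpoints in the window `S` (they are events of the open subgraph induced on `S`).  Hence two
graphs that agree on `S × S` have the same connection events in `S` (`siteConnIn_congr`), the
diagonal flip of a quadrilateral `(A, B, C, D)` whose two diagonals each have an endpoint outside
`S` changes no connection event in `S` (`siteConnIn_flipGraph_eq`), and the flip response of any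
event assembled from connection events in `S` vanishes for such quadrilaterals
(`flipResponse_eq_zero_of_apply_flipGraph_eq`).  This is what makes the kernel statement on a
bits leg ("`|Σ_{k ∈ K δ} E_t[Δ_k]| ≤ η δ`", typing draft no. 2) independent of the finite box
`K δ` of faces as soon as the box contains every face meeting the domain.
-/

noncomputable section

open MeasureTheory

namespace Summit.CriticalPhenomena.CardyFormulaZ2.Theorems

open Literature.Probability.Percolation

variable {V : Type*}

/-- Two graphs that agree on `S × S` induce the same open subgraph on `S`. [folklore] -/
theorem induce_siteOpenGraph_congr {G₁ G₂ : SimpleGraph V} {S : Set V}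
    (h : ∀ ⦃x y : V⦄, x ∈ S → y ∈ S → (G₁.Adj x y ↔ G₂.Adj x y)) (ω : SiteConfig V) :
    (siteOpenGraph G₁ ω).induce S = (siteOpenGraph G₂ ω).induce S := by
  ext u v
  simp only [SimpleGraph.comap_adj, Function.Embedding.coe_subtype, siteOpenGraph_adj]
  rw [h u.2 v.2]

/-- **Connection events in `S` only read the edges inside `S`.** If `G₁` and `G₂` agree on
`S × S`, then `{x ↔ y in S}` is the same event for both. [folklore] -/
theorem siteConnIn_congr {G₁ G₂ : SimpleGraph V} {S : Set V}
    (h : ∀ ⦃x y : V⦄, x ∈ S → y ∈ S → (G₁.Adj x y ↔ G₂.Adj x y)) (x y : V) :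
    siteConnIn G₁ S x y = siteConnIn G₂ S x y := by
  ext ω
  simp only [siteConnIn, Set.mem_setOf_eq, induce_siteOpenGraph_congr h ω]

/-- A diagonal flip whose two diagonals `AC`, `BD` each have an endpoint outside `S` does not
change adjacency inside `S`. [folklore] -/
theorem flipGraph_adj_iff_of_not_mem (G : SimpleGraph V) {A B C D : V} {S : Set V}
    (hAC : A ∉ S ∨ C ∉ S) (hBD : B ∉ S ∨ D ∉ S) {x y : V} (hx : x ∈ S) (hy : y ∈ S) :
    (flipGraph G A B C D).Adj x y ↔ G.Adj x y := by
  rw [flipGraph_adj]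
  have hne1 : s(x, y) ≠ s(A, C) := by
    intro heq
    rcases Sym2.eq_iff.1 heq with ⟨rfl, rfl⟩ | ⟨rfl, rfl⟩
    · exact hAC.elim (fun h => h hx) (fun h => h hy)
    · exact hAC.elim (fun h => h hy) (fun h => h hx)
  have hne2 : s(B, D) ≠ s(x, y) := by
    intro heq
    rcases Sym2.eq_iff.1 heq with ⟨rfl, rfl⟩ | ⟨rfl, rfl⟩
    · exact hBD.elim (fun h => h hx) (fun h => h hy)
    · exact hBD.elim (fun h => h hy) (fun h => h hx)
  constructor
  · rintro (⟨h, -⟩ | ⟨h, -⟩)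
    · exact h
    · exact absurd h hne2
  · exact fun h => Or.inl ⟨h, hne1⟩

/-- **A flip outside the window changes no connection event in the window.** [folklore] -/
theorem siteConnIn_flipGraph_eq (G : SimpleGraph V) {A B C D : V} {S : Set V}
    (hAC : A ∉ S ∨ C ∉ S) (hBD : B ∉ S ∨ D ∉ S) (x y : V) :
    siteConnIn (flipGraph G A B C D) S x y = siteConnIn G S x y :=
  siteConnIn_congr (fun _ _ hx hy => flipGraph_adj_iff_of_not_mem G hAC hBD hx hy) x y

/-- An event that does not see the flip has zero flip response. [folklore] -/
theorem flipResponse_eq_zero_of_apply_flipGraph_eq {G : SimpleGraph V} {A B C D : V}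
    {U : SimpleGraph V → Set (SiteConfig V)} (hU : U (flipGraph G A B C D) = U G)
    (p : unitInterval) : flipResponse G A B C D U p = 0 := by
  rw [flipResponse, hU, sub_self]

/-- **Locality of the flip response.** If the event `U G` is assembled from the connection
events of `G` in the window `S` — i.e. `U G₁ = U G₂` whenever all `siteConnIn Gᵢ S x y` agree —
then the flip response of a quadrilateral whose diagonals each have an endpoint outside `S`
vanishes. [folklore] -/
theorem flipResponse_eq_zero_of_not_mem {G : SimpleGraph V} {A B C D : V} {S : Set V}
    {U : SimpleGraph V → Set (SiteConfig V)}
    (hU : ∀ G₁ G₂ : SimpleGraph V,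
      (∀ x y : V, siteConnIn G₁ S x y = siteConnIn G₂ S x y) → U G₁ = U G₂)
    (hAC : A ∉ S ∨ C ∉ S) (hBD : B ∉ S ∨ D ∉ S) (p : unitInterval) :
    flipResponse G A B C D U p = 0 :=
  flipResponse_eq_zero_of_apply_flipGraph_eq
    (hU _ _ fun x y => siteConnIn_flipGraph_eq G hAC hBD x y) p

end Summit.CriticalPhenomena.CardyFormulaZ2.Theorems

end
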